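import Summits.CriticalPhenomena.SAWScalingLimit.Theses.SAWLeftRightFKG
import Summits.CriticalPhenomena.SAWScalingLimit.Theorems.LeftRightFKG.Negative.LatticeSegments
import Literature.Probability.LatticeModels.LatticeInterface

/-!
# Sketch (ideator 3, crux `NotFKGAtOne`, stmt-CriticalPhenomena-11233) — first lemmas of the two idea cards

Card 1 `corner-probe-endpoint-steps`: the corner-face probes READ the endpoint steps of every chord, so the
up-closedness half of the disprover's `Witness3x3` is structural (no enumeration).
Card 2 `kernel-certificate-checker`: a decidable certificate for `meshVertices (dom 1 C) 1 = V`, soundness once,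
instances by kernel `decide`.
Statements only (`sorry` bodies); everything is over existing declarations.
-/

namespace Summit.CriticalPhenomena.SAWScalingLimit.Cruxes.NotFKGAtOne.Ideator3

open Set MeasureTheory Literature.Probability.LatticeModels Literature.Probability.RandomPlanarGeometry
  Literature.Topology.PlaneTopology
  Summit.CriticalPhenomena.SAWScalingLimit.Theorems.LeftRightFKG.Negative

noncomputable section

/-! ## Verbatim copies of the LANDED `pathCross` / `wcross` (Theorems/LeftRightFKG/Negative/LatticePolylines.lean,
module not yet built on the farm at sketch time; `edgeCross`, `probeL` come from the built part 1 `LatticeSegments`) -/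

/-- Signed crossing count of the vertex chain `a, l₀, l₁, …` over the upward probe of face `(m,k)` (verbatim copy). -/
def pathCross (m k : ℤ) : Site 2 → List (Site 2) → ℤ
  | _, [] => 0
  | a, b :: l => edgeCross m k a b + pathCross m k b l

/-- Crossing count of a walk (verbatim copy of the landed `wcross`). -/
def wcross (m k : ℤ) {G : SimpleGraph (Site 2)} {u v : Site 2} (w : G.Walk u v) : ℤ :=
  pathCross m k u w.support.tail

/-! ## Read-back of the crux data (verbatim the disprover's `dom`, `lr`, `P`, `sq3`) -/

/-- `Ω(C, δ) = {wind ≠ 0}` (the crux's `let Ω`). -/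
def dom (δ : ℝ) {c : Site 2} (C : (zdGraph 2).Walk c c) : Set ℂ :=
  {z | wind (fun t : ℝ => IccExtend zero_le_one (C.toCurve (meshPoint δ)) t - z) ≠ 0}

/-- The crux's relation `le`. -/
def lr {Ω : Set ℂ} {δ : ℝ} {a b : Site 2} (γ₁ γ₂ : SAW.DomainSAW Ω δ a b) : Prop :=
  ∀ z : ℂ, 0 ≤ wind (fun t : ℝ =>
    IccExtend zero_le_one ((γ₁.walk.append γ₂.walk.reverse).toCurve (meshPoint δ)) t - z)

/-- Lattice point. -/
def P (x y : ℤ) : Site 2 := ![x, y]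

/-! ## Card 1 — first lemmas -/

/-- Signed count of crossings of the vertical line `re = m + 1/2` by the darts of a walk
(`+1` eastward `(m,y) → (m+1,y)`, `-1` westward), ALL rows. -/
def colFlux (m : ℤ) {G : SimpleGraph (Site 2)} {u v : Site 2} (w : G.Walk u v) : ℤ :=
  (w.darts.map fun d => (if d.fst 0 = m ∧ d.snd 0 = m + 1 then (1 : ℤ) else 0)
      - (if d.snd 0 = m ∧ d.fst 0 = m + 1 then (1 : ℤ) else 0)).sum

/-- **Telescoping**: the net column flux of a lattice walk only depends on its endpoints
(`X(v) = [m+1 ≤ v 0]` changes by exactly the summand along each unit dart). [first lemma, card 1] -/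
theorem colFlux_eq {G : SimpleGraph (Site 2)} (hG : ∀ x y, G.Adj x y → (zdGraph 2).Adj x y)
    (m : ℤ) {u v : Site 2} (w : G.Walk u v) :
    colFlux m w = (if m + 1 ≤ v 0 then 1 else 0) - (if m + 1 ≤ u 0 then 1 else 0) := by
  sorry

/-- **Corner probe at the source reads the first step.** For a self-avoiding lattice walk from
`a = (0,0)` to `b = (2,2)` with all vertices in the quadrant `0 ≤ x, 0 ≤ y`, the crossing count of the
upward probe from the face `(0,0)` (rows `≥ 1`, landed `wcross`) is `1 − [first step East]`
(= `[first step North]`): `colFlux 0 = 1` by telescoping, and the only row-`0` crossing between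
columns `0,1` is the edge at `a`, which a path can only use as its first dart. -/
theorem wcross_source_corner {G : SimpleGraph (Site 2)} (hG : ∀ x y, G.Adj x y → (zdGraph 2).Adj x y)
    (w : G.Walk (P 0 0) (P 2 2)) (hw : w.IsPath)
    (hquad : ∀ x ∈ w.support, 0 ≤ x 0 ∧ 0 ≤ x 1) :
    wcross 0 0 w = 1 - (if w.getVert 1 = P 1 0 then 1 else 0) := by
  sorry

/-- **Corner probe at the target reads the last step.** With all vertices of height `≤ 2`, the upward
probe from the face `(1,1)` is crossed only along the edge `(1,2)—(2,2)`, i.e. by the terminal dart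
iff the walk enters `b = (2,2)` from the West. -/
theorem wcross_target_corner {G : SimpleGraph (Site 2)} (hG : ∀ x y, G.Adj x y → (zdGraph 2).Adj x y)
    (w : G.Walk (P 0 0) (P 2 2)) (hw : w.IsPath) (htop : ∀ x ∈ w.support, x 1 ≤ 2) :
    wcross 1 1 w = (if w.reverse.getVert 1 = P 1 2 then 1 else 0) := by
  sorry

/-- **Structural up-closedness of the disprover's witness events** (consequence of the two readings and the
landed `wcross_le_of_wind_nonneg`): for ANY domain whose discrete vertices lie in the box `[0,2]²`
(the `⊆` half of the identification `meshDomain = {0,1,2}²`, i.e. `wind(C) = 0` off the open square),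
`A = {first step North}` and `B = {last step East}` are `≼`-up-closed among the chords `(0,0) → (2,2)`. -/
theorem upperSet_endpointSteps (Ω : Set ℂ)
    (hbox : meshDomain Ω 1 ⊆ {x | 0 ≤ x 0 ∧ x 0 ≤ 2 ∧ 0 ≤ x 1 ∧ x 1 ≤ 2}) :
    (∀ γ₁ γ₂ : SAW.DomainSAW Ω 1 (P 0 0) (P 2 2), lr γ₁ γ₂ →
        γ₁.walk.getVert 1 = P 0 1 → γ₂.walk.getVert 1 = P 0 1) ∧
    (∀ γ₁ γ₂ : SAW.DomainSAW Ω 1 (P 0 0) (P 2 2), lr γ₁ γ₂ →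
        γ₁.walk.reverse.getVert 1 = P 1 2 → γ₂.walk.reverse.getVert 1 = P 1 2) := by
  sorry

/-! ## Card 2 — first lemma: a decidable certificate for the discrete vertex set of `Ω(C)` -/

/-- Winding number of the closed lattice walk with vertex list `c :: rest` (returning to `c`) about the
centre of the face `(m, k)`, COMPUTED: minus the signed crossing count of the upward probe
(`pathCross`, landed; correct by `wind_poly_probeL`). -/
def windFace (s : List (Site 2)) (m k : ℤ) : ℤ :=
  match s with
  | [] => 0
  | c :: rest => -pathCross m k c rest

/-- The lattice points of the bounding box of a vertex list, enlarged by one. -/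
def boxSites (s : List (Site 2)) : Finset (Site 2) :=
  let xs := s.map (· 0); let ys := s.map (· 1)
  let x0 := (xs.min?.getD 0) - 1; let x1 := (xs.max?.getD 0) + 1
  let y0 := (ys.min?.getD 0) - 1; let y1 := (ys.max?.getD 0) + 1
  ((Finset.Icc x0 x1) ×ˢ (Finset.Icc y0 y1)).image fun p => P p.1 p.2

/-- **Certificate** that `V` is exactly the set of lattice points of non-zero winding number of the closed
walk with support `s`: every `v ∈ V` is off the trace with `windFace ≠ 0` at the face north-east of it
(same value as at `v`: the half-diagonal misses the trace), and every other lattice point of the enlarged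
bounding box is on the trace or has `windFace = 0` (points outside the box have winding `0` for free). -/
def domCert (s : List (Site 2)) (V : Finset (Site 2)) : Bool :=
  (decide (∀ v ∈ V, v ∉ s ∧ windFace s (v 0) (v 1) ≠ 0)) &&
  (decide (∀ p ∈ boxSites s, p ∉ V → (p ∈ s ∨ windFace s (p 0) (p 1) = 0)))

/-- **Soundness of the certificate** (first lemma of card 2): `meshVertices (Ω(C), 1) = V`.  Ingredients, all
landed: `wind_poly_probeL` (face centres), local constancy `wind_affine_sub_eq_of_segment` (lattice point ↔
adjacent face centre), junk `wind = 0` on the trace, `wind_poly_probeR`-type vanishing outside the box. -/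
theorem meshVertices_dom_one_eq {c : Site 2} (C : (zdGraph 2).Walk c c) (V : Finset (Site 2))
    (h : domCert C.support V = true) : meshVertices (dom 1 C) 1 = ↑V := by
  sorry

/-- For closed-walk domains the mesh graph on mesh vertices is the INDUCED `ℤ²` graph (a closed unit edge
between two off-trace lattice points misses the trace, so `wind` is constant on it), and a connected vertex
set is its own largest component: `discreteDomainGraph` is then explicit and decidable. -/
theorem discreteDomainGraph_dom_one_adj {c : Site 2} (C : (zdGraph 2).Walk c c) (V : Finset (Site 2))
    (hV : meshVertices (dom 1 C) 1 = ↑V)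
    (hconn : ((zdGraph 2).induce (↑V : Set (Site 2))).Connected) (x y : Site 2) :
    (discreteDomainGraph (dom 1 C) 1).Adj x y ↔ (zdGraph 2).Adj x y ∧ x ∈ V ∧ y ∈ V := by
  sorry

end

end Summit.CriticalPhenomena.SAWScalingLimit.Cruxes.NotFKGAtOne.Ideator3
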